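import Summits.RiemannHypothesis.RiemannHypothesis.Theorems.WeilTwoPrimeDeflM80FBase
import Summits.RiemannHypothesis.RiemannHypothesis.Theorems.WeilTwoPrimeDeflM80FDataPO29
import Literature.NumberTheory.LFunctions.WeilBlockRowsPZ
import Literature.NumberTheory.LFunctions.WeilBlockRowsFast
import Summits.RiemannHypothesis.RiemannHypothesis.Theorems.WeilLegendreBlocks136DataDn14
import HarnessLib

/-!
# Deflated two-prime certificate M80F: dominance of rows 40–41 of `R = S''_odd(κ') − UᵀU` (factored data)

`WeilCert.checkDomRowPZ` with the materialized augmented block, the factored inverse `weilBlocks136Dn/weilBlocks136Ls` and the Bessel block, by `decide +kernel` row by row. Pure proof file.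
-/

set_option linter.dupNamespace false

noncomputable section

namespace Summit.RiemannHypothesis.RiemannHypothesis.Theorems.EvenWinsBeyondArch

open Literature.NumberTheory.LFunctions

set_option maxHeartbeats 0 in
/-- Kernel check of the dominance of row 40 of `R` (odd block, certificate M80F). [folklore] -/
theorem checkDomRowF1_40_weilCertDeflM80F :
    weilCertDeflM80FBase.checkDomRowF weilCertDeflM80FPmO weilBlocks136Dn weilBlocks136Ls weilCertDeflM80FHpO weilCertDeflM80FKappa' 1 40 = true := by
  decide +kernel

/-- Kernel check of the dominance of row 40 of `R` (factored data), from the fast row. [folklore] -/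
theorem checkDomRowPZ1_40_weilCertDeflM80F :
    weilCertDeflM80FBase.checkDomRowPZ weilCertDeflM80FPmO weilBlocks136Dn weilBlocks136Ls weilCertDeflM80FHpO weilCertDeflM80FKappa' 1 40 = true :=
  WeilCert.checkDomRowPZ_of_F (by decide) checkDomRowF1_40_weilCertDeflM80F

set_option maxHeartbeats 0 in
/-- Kernel check of the dominance of row 41 of `R` (odd block, certificate M80F). [folklore] -/
theorem checkDomRowF1_41_weilCertDeflM80F :
    weilCertDeflM80FBase.checkDomRowF weilCertDeflM80FPmO weilBlocks136Dn weilBlocks136Ls weilCertDeflM80FHpO weilCertDeflM80FKappa' 1 41 = true := by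
  decide +kernel

/-- Kernel check of the dominance of row 41 of `R` (factored data), from the fast row. [folklore] -/
theorem checkDomRowPZ1_41_weilCertDeflM80F :
    weilCertDeflM80FBase.checkDomRowPZ weilCertDeflM80FPmO weilBlocks136Dn weilBlocks136Ls weilCertDeflM80FHpO weilCertDeflM80FKappa' 1 41 = true :=
  WeilCert.checkDomRowPZ_of_F (by decide) checkDomRowF1_41_weilCertDeflM80F


end Summit.RiemannHypothesis.RiemannHypothesis.Theorems.EvenWinsBeyondArch
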